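import Summits.KontsevichZagierPeriods.KontsevichZagierPeriods.Theorems.RootDecompWalshStrataBall4Planar

/-!
# The 4-ball specimen, part 4/4: the second descent and the assembly

Route `RootDecompWalshStrata` (cell decomp-kz, lens 4, gen 11), support toward `QuadricSignKernel`
(item stmt-KontsevichZagierPeriods-25393), slice `d = 4`.  The source domain `A₂` of part 3 is the open
band `0 < y₂ < b₂(t) = 1/√((1 − t₁)² + t₁²)` over the unit square; Newton–Leibniz along `y₂` with the
primitive `q(y₂²/2 − y₂⁴((1−y₁)²+y₁²)/4)/(2((1−y₀)²+y₀²))` (rule (3)) and opening the fibres (rule (1a))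
land on the RATIONAL 2-cell `R₂ = [(0,1)², q/(8((1 − t₀)² + t₀²)((1 − t₁)² + t₁²))]` (value
`q·(π/4)²/2 = q·π²/32`).  Main results: `of_cell_sub_of_sqRep_mem_relations`
(`[ball-orthant cell, q] − R₂ ∈ KZ.relations`) and `ball4_twoDescent` — the orthant of the 4-ball is
an instance of the `d = 4` quadric descent `QuadricTwoDescentFour` of the gen-11 node, decided INSIDE the
three KZ rules (five moves: chart, Newton–Leibniz, chart, Newton–Leibniz with the two fibre-openings; no
symmetry splitting, no transcendence input).  0 sorry.  [KontsevichZagier2001 §1.2]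
-/

noncomputable section
/-- `(1 − v)² + v² > 0`. [folklore] -/
private theorem gq_pos (v : ℝ) : 0 < (1 - v) ^ 2 + v ^ 2 := by nlinarith [sq_nonneg (1 - 2 * v)]

open Literature.NumberTheory.Transcendental
open MeasureTheory Set
open MvPolynomial (aeval X C)
open Literature.ModelTheory.ExponentialFields (IsSemialgebraic isSemialgebraic_setOf_eval_pos
  isSemialgebraic_setOf_eval_lt continuous_aeval_real)
open Summit.KontsevichZagierPeriods.RootDecompWalshStrata.WalshSpanProof (isSemialgebraic_cubeSet
  isBounded_cubeSet cellRep cellRep_domain cellRep_integrand)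
open Summit.KontsevichZagierPeriods.RootDecompWalshStrata.ConeSpecimen (cubeCell_subset_Icc cylPoly
  aeval_cylPoly)

namespace Summit.KontsevichZagierPeriods.RootDecompWalshStrata.Ball4

/-! #### The second band: `A₂` is the open band `0 < y₂ < 1/√((1 − y₁)² + y₁²)` over `(0,1)²` -/

/-- Coordinates of `Fin.snoc` on `ℝ² × ℝ`. [definition] -/
@[simp] theorem snoc₂_apply (t : Fin 2 → ℝ) (s : ℝ) :
    (Fin.snoc t s : Fin 3 → ℝ) 2 = s ∧ (Fin.snoc t s : Fin 3 → ℝ) 0 = t 0 ∧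
      (Fin.snoc t s : Fin 3 → ℝ) 1 = t 1 := ⟨rfl, rfl, rfl⟩

/-- The upper edge `b₂(t) = √(1/((1 − t₁)² + t₁²))` of the second band. -/
def bEdge₂ (t : Fin 2 → ℝ) : ℝ := √(1 / ((1 - t 1) ^ 2 + t 1 ^ 2))

/-- The upper edge is `ℚ`-semialgebraic on the square. [BCR1998 §2.2] -/
theorem isSemialgebraicFunOn_bEdge₂ : IsSemialgebraicFunOn ℚ sqSet bEdge₂ :=
  (IsSemialgebraicFunOn.sqrt_holds
    (isSemialgebraicFunOn_aeval_div_aeval isSemialgebraic_sqSet (1 : MvPolynomial (Fin 2) ℚ)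
      ((1 - X 1) ^ 2 + X 1 ^ 2) fun t _ => by simpa using (gq_pos (t 1)).ne')).congr fun t _ => by
    simp [bEdge₂]

/-- `b₂(t)² = 1/((1 − t₁)² + t₁²)`. [folklore] -/
theorem bEdge₂_sq (t : Fin 2 → ℝ) : bEdge₂ t ^ 2 = 1 / ((1 - t 1) ^ 2 + t 1 ^ 2) :=
  Real.sq_sqrt (div_pos one_pos (gq_pos (t 1))).le

/-- `b₂(t) < 2`. [folklore] -/
theorem bEdge₂_lt_two (t : Fin 2 → ℝ) : bEdge₂ t < 2 := by
  refine (Real.sqrt_lt' two_pos).2 ((div_lt_iff₀ (gq_pos (t 1))).2 ?_)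
  nlinarith [half_le_gq (t 1)]

/-- Membership in `A₂` in band form. [folklore] -/
theorem mem_srcSet₂_iff_init (y : Fin 3 → ℝ) :
    y ∈ srcSet₂ ↔ Fin.init y ∈ sqSet ∧ 0 < y (Fin.last 2) ∧ y (Fin.last 2) < bEdge₂ (Fin.init y) := by
  rw [mem_srcSet₂]
  have hG := gq_pos (y 1)
  have key : y 2 ^ 2 * ((1 - y 1) ^ 2 + y 1 ^ 2) = (y 2 * (1 - y 1)) ^ 2 + (y 2 * y 1) ^ 2 := by
    ring
  have hsq : Fin.init y ∈ sqSet ↔ (0 < y 0 ∧ y 0 < 1) ∧ (0 < y 1 ∧ y 1 < 1) := by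
    simp only [sqSet, mem_setOf_eq, Fin.init]
    constructor
    · intro hu
      exact ⟨hu 0, hu 1⟩
    · rintro ⟨h0, h1⟩ j
      fin_cases j
      · exact h0
      · exact h1
  have hb : bEdge₂ (Fin.init y) = √(1 / ((1 - y 1) ^ 2 + y 1 ^ 2)) := rfl
  have hl : y (Fin.last 2) = y 2 := rfl
  rw [hsq, hb, hl]
  constructor
  · rintro ⟨h0, h1, h2, hP⟩
    refine ⟨⟨h0, h1⟩, h2, (Real.lt_sqrt h2.le).2 ((lt_div_iff₀ hG).2 ?_)⟩
    rw [key]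
    linarith
  · rintro ⟨⟨h0, h1⟩, h2, hlt⟩
    have h' : y 2 ^ 2 < 1 / ((1 - y 1) ^ 2 + y 1 ^ 2) := (Real.lt_sqrt h2.le).1 hlt
    have h'' : y 2 ^ 2 * ((1 - y 1) ^ 2 + y 1 ^ 2) < 1 := (lt_div_iff₀ hG).1 h'
    refine ⟨h0, h1, h2, ?_⟩
    rw [key] at h''
    linarith

/-- The closed second band lies in `[0,2]³`. [folklore] -/
theorem band_sqSet_subset_Icc : KZlog.band sqSet (fun _ => (0:ℝ)) bEdge₂ ⊆ Icc 0 2 := by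
  intro y hy
  rw [KZlog.mem_band] at hy
  obtain ⟨hu, h0, h1⟩ := hy
  have hlt := bEdge₂_lt_two (Fin.init y)
  refine ⟨fun j => ?_, fun j => ?_⟩
  · fin_cases j
    · exact (hu 0).1.le
    · exact (hu 1).1.le
    · exact h0
  · fin_cases j
    · exact ((hu 0).2.trans one_lt_two).le
    · exact ((hu 1).2.trans one_lt_two).le
    · exact (h1.trans hlt.le)

/-! #### Moves (3) + (1a): `[A₂, …] ≡ R₂` -/

/-- **Moves (3) + (1a):** Newton–Leibniz along `y₂` with the primitive
`q(y₂²/2 − y₂⁴((1−y₁)²+y₁²)/4)/(2((1−y₀)²+y₀²))` over the unit square (closed fibres `[0, b₂(t)]`),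
then opening the fibres: `[A₂, …] − R₂ ∈ KZ.relations`. [KontsevichZagier2001 §1.2 rules (1), (3)] -/
theorem of_srcRep₂_sub_of_sqRep_mem_relations (q : ℚ) :
    KZ.of (srcRep₂ q) - KZ.of (sqRep q) ∈ KZ.relations := by
  have hBs := isSemialgebraic_sqSet
  have ha : IsSemialgebraicFunOn ℚ sqSet (fun _ => (0:ℝ)) := by
    simpa using isSemialgebraicFunOn_ratCast hBs 0
  have hb : IsSemialgebraicFunOn ℚ sqSet bEdge₂ := isSemialgebraicFunOn_bEdge₂
  have hband : IsSemialgebraic ℚ (KZlog.band sqSet (fun _ => (0:ℝ)) bEdge₂) :=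
    KZlog.isSemialgebraic_band ha hb
  set F : (Fin 3 → ℝ) → ℝ := fun y =>
    (q : ℝ) * (y 2 ^ 2 / 2 - y 2 ^ 4 * ((1 - y 1) ^ 2 + y 1 ^ 2) / 4) / (2 * ((1 - y 0) ^ 2 + y 0 ^ 2))
    with hFdef
  have hbdry : ∀ t ∈ sqSet,
      F (Fin.snoc t (bEdge₂ t)) - F (Fin.snoc t ((fun _ => (0:ℝ)) t)) = (sqRep q).integrand t := by
    intro t _
    simp only [hFdef, snoc₂_apply, sqRep_integrand]
    have h4 : bEdge₂ t ^ 4 = (bEdge₂ t ^ 2) ^ 2 := by ring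
    rw [h4, bEdge₂_sq t]
    have hG0 := (gq_pos (t 0)).ne'
    have hG1 := (gq_pos (t 1)).ne'
    field_simp
    ring
  obtain ⟨rb, rd, hrbd, hrbi, hrdd, hrdi, hrel⟩ := KZ.exists_band_newtonLeibniz hBs
    (fun _ => (0:ℝ)) bEdge₂ ha hb (fun _ _ => Real.sqrt_nonneg _) F
    (fun y => (q : ℝ) * (1 - (y 2 * (1 - y 1)) ^ 2 - (y 2 * y 1) ^ 2) * y 2 /
      (2 * ((1 - y 0) ^ 2 + y 0 ^ 2)))
    ((isSemialgebraicFunOn_aeval_div_aeval hband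
      (C q * (C (1 / 2) * X 2 ^ 2 - C (1 / 4) * X 2 ^ 4 * ((1 - X 1) ^ 2 + X 1 ^ 2)))
      (2 * ((1 - X 0) ^ 2 + X 0 ^ 2)) fun y _ => by simpa using (gq_pos (y 0)).ne').congr
      fun y _ => by
        simp only [hFdef]
        simp
        ring)
    ((isSemialgebraicFunOn_aeval_div_aeval hband
      (C q * (1 - (X 2 * (1 - X 1)) ^ 2 - (X 2 * X 1) ^ 2) * X 2) (2 * ((1 - X 0) ^ 2 + X 0 ^ 2))
      fun y _ => by simpa using (gq_pos (y 0)).ne').congr fun y _ => by simp)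
    (fun t _ => by
      simp only [hFdef, snoc₂_apply]
      exact ((continuous_const.mul (((continuous_pow 2).div_const _).sub
        (((continuous_pow 4).mul continuous_const).div_const _))).div_const _).continuousOn)
    (fun t _ s _ => by
      simp only [hFdef, snoc₂_apply]
      exact (((((hasDerivAt_pow 2 s).div_const 2).sub
        (((hasDerivAt_pow 4 s).mul_const ((1 - t 1) ^ 2 + t 1 ^ 2)).div_const 4)).const_mul
        (q : ℝ)).div_const (2 * ((1 - t 0) ^ 2 + t 0 ^ 2))).congr_deriv (by ring))
    (((continuous_srcInt₂ q).continuousOn.integrableOn_compact isCompact_Icc).mono_set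
      band_sqSet_subset_Icc)
    ((sqRep q).isSemialgebraicFunOn_integrand.congr fun t ht => (hbdry t ht).symm)
    (((sqRep q).integrableOn.congr_fun (fun t ht => (hbdry t ht).symm)
      isSemialgebraic_sqSet.measurableSet_holds))
  obtain ⟨rb', hrb'd, hrb'i, hrel'⟩ := KZ.of_sub_of_restrict_openBand_mem_relations ha hb rb hrbd
  have hpin1 : KZ.of rb' - KZ.of (srcRep₂ q) ∈ KZ.relations := by
    refine KZ.of_sub_of_mem_relations_of_eqOn ?_ fun y _ => ?_
    · rw [hrb'd, srcRep₂_domain]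
      ext y
      exact mem_srcSet₂_iff_init y
    · rw [hrb'i, hrbi]
      rfl
  have hpin2 : KZ.of rd - KZ.of (sqRep q) ∈ KZ.relations := by
    refine KZ.of_sub_of_mem_relations_of_eqOn ?_ fun t ht => ?_
    · rw [sqRep_domain, hrdd]
    · rw [hrdi]
      rw [hrdd] at ht
      exact hbdry t ht
  have : KZ.of (srcRep₂ q) - KZ.of (sqRep q) =
      (KZ.of rb - KZ.of rd) - (KZ.of rb - KZ.of rb') - (KZ.of rb' - KZ.of (srcRep₂ q)) +
        (KZ.of rd - KZ.of (sqRep q)) := by abel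
  rw [this]
  exact add_mem (sub_mem (sub_mem hrel hrel') hpin1) hpin2

/-! #### Assembly: the orthant of the 4-ball lands on the rational 2-cell `R₂` -/

/-- **`[(0,1)⁴ ∩ {Σ xᵢ² < 1}, q] − R₂ ∈ KZ.relations`:** the orthant of the unit 4-ball with constant
weight `q` is equivalent under the three KZ rules to the RATIONAL dimension-2 representation
`R₂ = [(0,1)², q/(8((1 − t₀)² + t₀²)((1 − t₁)² + t₁²))]` (`q·π²/32` both sides; five moves:
chart, Newton–Leibniz, chart, Newton–Leibniz, with the two fibre-openings).
[KontsevichZagier2001 §1.2; this node] -/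
theorem of_cell_sub_of_sqRep_mem_relations (q : ℚ) :
    KZ.of (cellRep ball4Poly q) - KZ.of (sqRep q) ∈ KZ.relations := by
  have h1 := of_cell_sub_of_cylWRep_mem_relations q
  have h2 := of_srcRep₂_sub_of_cylWRep_mem_relations q
  have h3 := of_srcRep₂_sub_of_sqRep_mem_relations q
  have : KZ.of (cellRep ball4Poly q) - KZ.of (sqRep q) =
      (KZ.of (cellRep ball4Poly q) - KZ.of (cylWRep q)) -
        (KZ.of (srcRep₂ q) - KZ.of (cylWRep q)) + (KZ.of (srcRep₂ q) - KZ.of (sqRep q)) := by abel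
  rw [this]
  exact add_mem (sub_mem h1 h2) h3

/-- **The orthant of the 4-ball is an instance of the `d = 4` quadric descent** (`P = 1 − Σ xᵢ²`,
any rational weight `q`): every representation with the orthant cell as domain and integrand `q` is
equivalent, modulo `KZ.relations`, to an element of the closure of the RATIONAL representations of
dimension `≤ 2`.  Decided INSIDE the rules — no transcendence input; the `P := ball4Poly` instance of
`QuadricTwoDescentFour` (gen-11 node).  [KontsevichZagier2001 §1.2; this node] -/
theorem ball4_twoDescent (q : ℚ) (ρ : KZ.IntegralRep 4)
    (hρ : ρ.domain = {x | (∀ j, 0 < x j ∧ x j < 1) ∧ 0 < MvPolynomial.aeval x ball4Poly} ∧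
      ∀ x ∈ ρ.domain, ρ.integrand x = (q : ℝ)) :
    ∃ y ∈ AddSubgroup.closure
        {y : KZ.FormalRep | ∃ (m : ℕ) (N : KZ.IntegralRep m), m ≤ 2 ∧ N.IsRational ∧ y = KZ.of N},
      KZ.of ρ - y ∈ KZ.relations := by
  refine ⟨KZ.of (sqRep q),
    AddSubgroup.subset_closure ⟨2, sqRep q, le_rfl, isRational_sqRep q, rfl⟩, ?_⟩
  have hpin : KZ.of ρ - KZ.of (cellRep ball4Poly q) ∈ KZ.relations :=
    KZ.of_sub_of_mem_relations_of_eqOn hρ.1.symm fun x hx => by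
      rw [hρ.2 x hx, cellRep_integrand]
  have : KZ.of ρ - KZ.of (sqRep q) =
      (KZ.of ρ - KZ.of (cellRep ball4Poly q)) +
        (KZ.of (cellRep ball4Poly q) - KZ.of (sqRep q)) := by abel
  rw [this]
  exact add_mem hpin (of_cell_sub_of_sqRep_mem_relations q)

end Summit.KontsevichZagierPeriods.RootDecompWalshStrata.Ball4

end
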